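import Literature.LinearAlgebra.QuadraticForm.WittCancellation
import HarnessLib

/-!
# Witt cancellation with a common summand: `Λ ⊥ D ≅ N ⊥ T` and `Λ ≅ N' ⊥ T` give `N ≅ D ⊥ N'`

Topic `LinearAlgebra/QuadraticForm`; namespace `Literature.LinearAlgebra.QuadraticForm`. KERNEL mathematics only
(theorems; no definition, no named fact, no sorry): a corollary of the tree's Witt cancellation theorem
`equivalent_of_prod_equivalent_prod_right` ([Knebusch2010, Ch. 1 §1.2 Thm. 1.9]; `WittCancellation.lean`) in
Mathlib's `QuadraticMap.prod` ∕ `QuadraticMap.Equivalent` vocabulary, in the shape used by lattice-theoretic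
consumers (Néron–Severi ∕ transcendental splittings of two cohomology lattices sharing the transcendental part):

* `equivalent_prod_assoc` — `(Q₁ ⊥ Q₂) ⊥ Q₃ ≅ Q₁ ⊥ (Q₂ ⊥ Q₃)` (re-bracketing; Mathlib has `prodComm` and
  `prodProdProdComm` but no associator for quadratic maps);
* `equivalent_prod_of_common_summand` — for quadratic spaces over a field with `2 ≠ 0`, all finite-dimensional,
  `T` and `N` with nondegenerate polar forms: `Λ ⊥ D ≅ N ⊥ T` and `Λ ≅ N' ⊥ T` imply `N ≅ D ⊥ N'`
  (`N ⊥ T ≅ Λ ⊥ D ≅ (N' ⊥ T) ⊥ D ≅ (D ⊥ N') ⊥ T`, cancel `T`);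
* `exists_apply_eq_of_equivalent_prod` — a value of `D` is a value of any `N ≅ D ⊥ N'`.

Consumer: cell hodge-nonav, route MarkmanPartnerTransport (K3 partners of `K3^{[2]}`-type fourfolds: `H²(X)_ℚ ≅
Λ_ℚ ⊥ ⟨−2⟩ = NS(X)_ℚ ⊥ T`, `H²(S)_ℚ ≅ Λ_ℚ = NS(S)_ℚ ⊥ T` ⇒ `NS(X)_ℚ ≅ ⟨−2⟩ ⊥ NS(S)_ℚ` represents `−2`).

## References

* [Knebusch2010] M. Knebusch, *Specialization of Quadratic and Symmetric Bilinear Forms*, Springer (2010), Ch. 1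
  §1.2, Thm. 1.9 (Witt's Cancellation Theorem).
* [Iversen1992] B. Iversen, *Hyperbolic Geometry*, CUP (1992), Ch. I §2 Thm. 2.4.
-/

namespace Literature.LinearAlgebra.QuadraticForm

open QuadraticMap Module

universe u v v₁ v₂ v₃ v₄

variable {K : Type u} [Field K]
variable {V₁ : Type v₁} [AddCommGroup V₁] [Module K V₁]
variable {V₂ : Type v₂} [AddCommGroup V₂] [Module K V₂]
variable {V₃ : Type v₃} [AddCommGroup V₃] [Module K V₃]
variable {V₄ : Type v₄} [AddCommGroup V₄] [Module K V₄]

/-- **Re-bracketing of orthogonal sums**: `(Q₁ ⊥ Q₂) ⊥ Q₃ ≅ Q₁ ⊥ (Q₂ ⊥ Q₃)` (the linear associator is an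
isometry). [cite: Knebusch2010, Ch. 1 §1.2 (orthogonal sums)] -/
theorem equivalent_prod_assoc (Q₁ : QuadraticForm K V₁) (Q₂ : QuadraticForm K V₂) (Q₃ : QuadraticForm K V₃) :
    ((Q₁.prod Q₂).prod Q₃).Equivalent (Q₁.prod (Q₂.prod Q₃)) :=
  ⟨{ toLinearEquiv := LinearEquiv.prodAssoc K V₁ V₂ V₃
     map_app' := fun x => by
       rcases x with ⟨⟨a, b⟩, c⟩
       simp only [QuadraticMap.prod_apply]
       change Q₁ a + (Q₂ b + Q₃ c) = Q₁ a + Q₂ b + Q₃ c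
       rw [add_assoc] }⟩

/-- **Witt cancellation with a common summand** ([Knebusch2010, Thm. 1.9], through the tree's
`equivalent_of_prod_equivalent_prod_right`): over a field with `2 ≠ 0`, for finite-dimensional quadratic spaces
with `T` and `N` nondegenerate (polar forms), `Λ ⊥ D ≅ N ⊥ T` and `Λ ≅ N' ⊥ T` imply `N ≅ D ⊥ N'`.
[cite: Knebusch2010, Ch. 1 §1.2 Thm. 1.9] -/
theorem equivalent_prod_of_common_summand [NeZero (2 : K)] [FiniteDimensional K V₁] [FiniteDimensional K V₂]
    [FiniteDimensional K V₃] [FiniteDimensional K V₄] {V : Type v} [AddCommGroup V] [Module K V]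
    [FiniteDimensional K V]
    {Λ : QuadraticForm K V} {D : QuadraticForm K V₁} {N : QuadraticForm K V₂} {T : QuadraticForm K V₃}
    {N' : QuadraticForm K V₄}
    (hT : (polarForm T).Nondegenerate) (hN : (polarForm N).Nondegenerate)
    (h₁ : (Λ.prod D).Equivalent (N.prod T)) (h₂ : Λ.Equivalent (N'.prod T)) :
    N.Equivalent (D.prod N') := by
  -- `N ⊥ T ≅ Λ ⊥ D ≅ (N' ⊥ T) ⊥ D ≅ D ⊥ (N' ⊥ T) ≅ (D ⊥ N') ⊥ T`
  have hcomm : ((N'.prod T).prod D).Equivalent (D.prod (N'.prod T)) :=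
    ⟨QuadraticMap.IsometryEquiv.prodComm (N'.prod T) D⟩
  have h3 : (N.prod T).Equivalent ((D.prod N').prod T) :=
    h₁.symm.trans <| (h₂.prod (QuadraticMap.Equivalent.refl D)).trans <|
      hcomm.trans (equivalent_prod_assoc D N' T).symm
  exact (equivalent_of_prod_equivalent_prod_right hT hN h3.symm).symm

/-- **A value of `D` is a value of any `N ≅ D ⊥ N'`** (`N (e⁻¹(d, 0)) = D d`). [cite: Knebusch2010, Ch. 1 §1.2] -/
theorem exists_apply_eq_of_equivalent_prod {D : QuadraticForm K V₁} {N : QuadraticForm K V₂}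
    {N' : QuadraticForm K V₄} (h : N.Equivalent (D.prod N')) (d : V₁) : ∃ n : V₂, N n = D d := by
  obtain ⟨e⟩ := h
  refine ⟨e.symm (d, 0), ?_⟩
  rw [← e.map_app (e.symm (d, 0)), QuadraticMap.IsometryEquiv.apply_symm_apply, QuadraticMap.prod_apply, map_zero,
    add_zero]

end Literature.LinearAlgebra.QuadraticForm
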